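import Literature.MathematicalPhysics.QuantumFieldTheory.Balaban1983to89.B9Thm311PosDefOpenZd
import Literature.MathematicalPhysics.QuantumFieldTheory.Balaban1983to89.B9Eq310DeltaPrimeContinuityZd
import Literature.MathematicalPhysics.QuantumFieldTheory.Balaban1983to89.B9Eq325ProjContinuityZd
import Literature.MathematicalPhysics.QuantumFieldTheory.Balaban1983to89.B8CubeMemberLevelDisjoint
import Literature.MathematicalPhysics.QuantumFieldTheory.Balaban1983to89.B9Eq326DeltaAHermitianZdCurved

/-!
# `Balaban1983to89.B9Thm311PosDefNearFlatZd` — [Balaban1985BackgroundPropagators] THEOREM 3.11 NEAR THE FLAT BACKGROUND AT EVERY CUBE MEMBER, STEP (ii) CLOSED: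
# the four letters of the genuine `Δ_a(U₀)` (`opsAllZd`: `D*D`, `Δ′`, `D R(U₀) 𝟙D*`, `Q*aQ`) are CONTINUOUS IN THE BACKGROUND within the small-field regime at
# `U₀ = 1`, hence (FILE 1's engine + dag-n06-b's flat base case) `⟨A, Δ_a(U₀)A⟩_τ > 0` on the Hermitian fields of `E(□₀)` — and, given the structural inputs
# (ℝ-linearity, Hermiticity preservation: dag-n06-w2 g3), `Δ_a(U₀)↾□₀` invertible on `E_𝔤(□₀)` — for ALL backgrounds of the regime NEAR `U₀ = 1`

statement-level skeleton of published theorems with citation tags; proofs where landed; nothing here is a claim about the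
Yang–Mills mass gap

`[Balaban1985BackgroundPropagators]` ("B9", CMP **99** (1985) 389–434) p. 416, Theorem 3.11: *«Under the assumptions of the Theorems 3.1–3.10 (i.e. for M
sufficiently large and α₀ sufficiently small) the operators Δ′_a, G′, (Q′G′²Q′*)⁻¹, Δ_a, G are positive definite.»*; its proof (p. 416) starts from the flat
case: *«In [4] we have proved that the operator G_□(1) is positive»* and perturbs.  (3.16) p. 393 (`Q*aQ`), (3.26)–(3.27) p. 395, (3.35) p. 396 (the
small-field class), [Balaban1985RegularSpaces] (1.7) p. 77 (the regime `𝔄` of the averaging operators).  PDF held: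
`paper:balaban1985-cmp99-background-propagators` pp. 393–396, 416 (re-read by this seat, 2026-08-28).

CITATION HEADER (lean-in-tree rule).  Cell `pub-ymgap` (YM Track A, HUMAN RULING D-0062 ∕ D-0149 width push), DAG node N06 = [B9], width seat
`pub-ymgap-dag-n06-w4` (g3), FILE 6 = the ASSEMBLY of the IDEA-3.11 STEP (ii) road: FILE 1 `B9Thm311PosDefOpenZd` (p605686: the engine + `D*D`), FILE 2
`B9Eq310DeltaPrimeContinuityZd` (p606545: `Δ′`), FILE 3 `B7Eq43AveragingContinuity` (p606675: the averaging machinery), FILE 4 `B9Eq325ProjFormulaZdLevels`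
((3.25) with level-bounded unitarity), FILE 5 `B9Eq325ProjContinuityZd` (`D R D*`); dag-n06-b g18 `B9Thm311FlatHermKernelZd.flat_posDef_herm_cube` (p604421,
the flat base case), `B9Eq327GreenZdHerm` (p604417, `E_𝔤`, `HermPreservingAt`, `RegularAtH`); dag-n05-c g15 `B8CubeMemberLevelDisjoint.qprimeStarInjective_cubeLamS`
(p602862, «Q′ onto» at the cube member for every background).  The structural inputs at curved `U₀` — `LinearOnDomAt` and `HermPreservingAt` of `opsAllZd` on
the regime set — are dag-n06-w2 g3's CLAIM-1 (l.28928) and enter the last two theorems as displayed hypotheses.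

WHAT IS PROVED (kernel, 0 sorry; theorems only — no `def`, `instance`, `notation`).
* §1 (the `Q*aQ` letter) `continuousAt_entryT`, ★ `continuousAt_linCovIterT` (the `τ`-transpose of `LʲηQ_j(U₀)` on a background-dependent field, jointly),
  `continuousAt_clsField`, ★★ `continuousAt_QQZdP_branch` (print's `Σ_j w_j Q_jᵀ(𝟙_{Λ_j}LʲηQ_j(U₀)A)` continuous at every background whose lower averages are in
  the disc of (21)), ★★ `continuousWithinAt_QQZdP` (the total letter `QQZdP` — `0` off the class (1.7) — is continuous WITHIN any set of (1.7)-backgrounds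
  at `U₀ = 1`).
* §2 (assembly, any member with finite `Ω₀` and finite level-`m` constraint sets, any `𝒰 ∋ 1` inside {unitary} ∩ (1.7) ∩ {`Ū₀ʲ(Γ)` unitary, `j ≤ m`}, `Q′*`
  injective at every background) ★★★ `lettersContinuousWithinAt_opsAllZd_one` — `LettersContinuousWithinAt i.η (opsAllZd …) (i.Ω 0) (domSubH (i.Ω 0)) 𝒰 1`:
  THE DISPLAYED CONTINUITY HYPOTHESIS OF FILE 1 §4 IS A THEOREM.
* §3 (cube members `cubeFam false ∕ cubeLamS`, class `cubeLamBP`, `m ≤ k`, `d, L ≥ 2`, `L ≤ ρ`) `qprimeStarInjective_cubeMember`,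
  ★★★ `lettersContinuousWithinAt_opsAllZd_one_cube`; ★★★ `bondPair_pos_eventually_one_cube_of_lin` — given only `LinearOnDomAt` on `𝒰`:
  `∀ᶠ U₀ in 𝓝[𝒰] 1, ∀ Hermitian 0 ≠ A ∈ E(□₀), 0 < ⟨A, Δ_a(U₀)A⟩_τ` (THEOREM 3.11's POSITIVITY AT CURVED BACKGROUNDS NEAR `1`, member-dependent
  neighbourhood); ★★★ `regularAtH_eventually_one_cube_of_lin_herm` (+ `HermPreservingAt` on `𝒰` ⟹ `Δ_a(U₀)↾□₀` invertible on `E_𝔤(□₀)`, i.e. `G_𝔤(U₀)` exists,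
  for all `U₀ ∈ 𝒰` near `1`); ★★ `exists_finset_delta_posDef_cube_of_lin` (the bond-variable reading: ∃ finite `F ⊂ ℤᵈ`, `δ > 0` …).
* §4 (UNCONDITIONAL CLOSE on dag-n06-w2 g3's regime set `𝒰′ = {U₀ unitary, (1.7) on ℤᵈ up to level m, window α_Q∕L²}`, `B9Eq326DeltaAHermitianZdCurved` p607675)
  `reg17_of_univ`, ★ `bgT_mem_unitaryUnits_of_reg17UnivP` ([5] Prop. 2 on `𝒰′`: `Ū₀ʲ` unitary for `j ≤ m`), ★★★★ `bondPair_pos_eventually_one_cube_reg17UnivP`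
  (`∀ᶠ U₀ in 𝓝[𝒰′] 1`, every Hermitian `0 ≠ A ∈ E(□₀)`: `0 < ⟨A, Δ_a(U₀)A⟩_τ` — NO displayed hypothesis left), ★★★★ `regularAtH_eventually_one_cube_reg17UnivP`
  (`Δ_a(U₀)↾□₀` invertible on `E_𝔤(□₀)` for all `U₀ ∈ 𝒰′` near `1`), ★★★ `exists_finset_delta_posDef_cube_reg17UnivP` (finite-`F`∕`δ` reading).

HONEST SCOPE.  (i) This closes STEP (ii) of the per-member road: continuity is proved for all four letters, and with dag-n06-w2 g3's structural theorems on
`𝒰′` the positivity ∕ invertibility near the flat background are UNCONDITIONAL theorems about the typed objects at every cube member (§4).  (ii) The neighbourhood is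
MEMBER-DEPENDENT and non-quantitative (compactness); print's Theorem 3.11 is UNIFORM in the class (3.35) with constants `M₀, α₀′` — that uniformity (Sects.
B–E, (3.115)) is NOT proved here; nor is step (iii) (gauge covariance + [5] Prop. 6: dag-n06-w3 g3).  (iii) Count-neutral; N05 ∕ N06 NOT discharged; K1⁷
`stmt-QuantumFields-20542` NOT closed; one finite `𝕋⁴` programme at fixed `ε`, Bałaban as printed; R4 closes only the conditional finite-`𝕋⁴` rung
`BalabanLadder.UV` — nothing continuum ∕ ℝ⁴ ∕ OS ∕ mass gap ∕ Clay.  Unit `pub-ymgap-dag-n06-w4` (g3), 2026-08-28.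
-/

noncomputable section

namespace Literature.MathematicalPhysics.QuantumFieldTheory.Balaban1983to89.B9Thm311PosDefNearFlatZd

open Filter Topology
open B7Prop1Explicit
open B7Prop2Explicit (unitaryUnits avgIter)
open B8Eq119TwistedAxial (bgT)
open B8Ineq132 (BondTouches)
open B8LeafModelZd (ZdIdx)
open B8Eq155JBound (Jcur)
open B7Prop4GeneralLevels (linCovIter)
open B9SupplySockB9P3ZdLetters (OpsZd deltaAOf)
open B9SupplySockB9P3ZdAllLettersZd (opsAllZd opsAllZd_Dp opsAllZd_QQ opsAllZd_DRDs)
open B9Eq316AveragingTransposeZd (tauForm tauForm_apply entryT linCovIterT clsField wQ Reg17 alphaQ reg17_one winBase)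
open B9Eq316AveragingTransposeZdPrinted (QQZdP withQQP)
open B9Eq369CurvSmallZd (DpZd)
open B9SupplySockB9P3ZdGammaInAkDpZd (withDpZd)
open B9Eq321LandauProjectionZd (opsLandau)
open B9Eq325QGGQInvZd (QprimeStarInjective)
open B9Eq327GreenZd (domSub bondPair LinearOnDomAt)
open B9Eq327GreenZdHerm (domSubH domSubH_le mem_domSubH_iff HermPreservingAt RegularAtH regularAtH_of_bondPair_pos)
open B9Thm311PosDefOpenZd (LettersContinuousWithinAt continuous_Jcur bondPair_pos_eventually_domSubH exists_finset_ball_of_eventually_nhdsWithin)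
open B9Eq310DeltaPrimeContinuityZd (continuous_DpZd)
open B7Eq43AveragingContinuity (continuousAt_linCovIter)
open B9Eq325ProjContinuityZd (continuousAt_re_tau continuousAt_bgT continuousAt_DRDs_opsLandau)
open B7Prop5Flat (bump)

-- `Site` alone could resolve to the torus sites of `Setup.lean`; re-export the `ℤ^d` sites of `B7Prop1Explicit`.
export B7Prop1Explicit (Site)

variable {d : ℕ} {𝔸 : Type*} [CStarAlgebra 𝔸] [FiniteDimensional ℝ 𝔸] [Nontrivial 𝔸]

/-! ## §1  The `Q*aQ` letter (3.16) is continuous in the background -/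

section Averaging

variable (τ : 𝔸 →ₗ[ℂ] ℂ) {Z : Type*} [TopologicalSpace Z] {z₀ : Z}

omit [Nontrivial 𝔸] in
open Classical in
/-- a `τ`-transpose entry `Σ_i ⟨v_z, E_z(b_i)⟩_τ·b^i` is continuous when `v_z` and the columns `E_z(b_i)` are. [cite: Balaban1985BackgroundPropagators, (3.16) p.393 («Q*_j», the adjoint), p.391] -/
theorem continuousAt_entryT {E : Z → 𝔸 → 𝔸} {v : Z → 𝔸} (hE : ∀ X : 𝔸, ContinuousAt (fun z => E z X) z₀) (hv : ContinuousAt v z₀) :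
    ContinuousAt (fun z => entryT τ (E z) (v z)) z₀ := by
  by_cases h : (tauForm τ).Nondegenerate
  · simp only [entryT, dif_pos h]
    refine tendsto_finsetSum _ fun i _ => ?_
    have hc : ContinuousAt (fun z => tauForm τ (v z) (E z (Module.finBasis ℝ 𝔸 i))) z₀ := by
      simp only [tauForm_apply]
      exact continuousAt_re_tau τ hv (hE _)
    exact hc.smul continuousAt_const
  · simp only [entryT, dif_neg h]
    exact continuousAt_const

variable (L : ℕ) {U : Z → Site d → Fin d → 𝔸ˣ} (hU : ContinuousAt U z₀)

include hU in
/-- ★ **THE TRANSPOSE `Q_jᵀ B` OF THE LINEARISED AVERAGING IS CONTINUOUS IN (BACKGROUND, FIELD)** at a background whose lower averages `Ū_{z₀}ⁱ`, `i < j`, have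
their loop variables in the disc of (21) (FILE 3's `continuousAt_linCovIter` on the columns `LʲηQ_j(U)(X·δ_b)`). [cite: Balaban1985BackgroundPropagators, (3.16) p.393; Balaban1985Averaging, (147) p.40] -/
theorem continuousAt_linCovIterT (j : ℕ)
    (hsmall : ∀ i, i < j → ∀ (q : Site d) (κ : Fin d) (r : Fin d → Fin L), ‖((Wcx L (avgIter L (U z₀) i) q κ (boxVec L r) : 𝔸ˣ) : 𝔸) - 1‖ < 1)
    {B : Z → Site d → Fin d → 𝔸} (hB : ∀ (w : Site d) (κ : Fin d), ContinuousAt (fun z => B z w κ) z₀) (y : Site d) (μ : Fin d) :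
    ContinuousAt (fun z => linCovIterT τ L (U z) j (B z) y μ) z₀ := by
  unfold linCovIterT
  refine tendsto_finsetSum _ fun κ _ => tendsto_finsetSum _ fun t _ => ?_
  refine continuousAt_entryT τ (fun X => ?_) (hB _ κ)
  have h := continuousAt_linCovIter L hU (B := fun _ => bump y μ X) continuousAt_const j hsmall
  have h' : Continuous fun F : Site d → Fin d → 𝔸 => F (winBase L j y κ t) κ := (continuous_apply κ).comp (continuous_apply _)
  exact h'.continuousAt.comp h

include hU in
omit [FiniteDimensional ℝ 𝔸] in
/-- **the class field `𝟙_{Λ_j}·LʲηQ_j(U)(iηA)` of a fixed bond field is continuous in the background** (same smallness). [cite: Balaban1985BackgroundPropagators, (3.16) p.393] -/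
theorem continuousAt_clsField (ΛbP : ℕ → ℕ → Set (Site d × Fin d)) (η : ℝ) (m j : ℕ)
    (hsmall : ∀ i, i < j → ∀ (q : Site d) (κ : Fin d) (r : Fin d → Fin L), ‖((Wcx L (avgIter L (U z₀) i) q κ (boxVec L r) : 𝔸ˣ) : 𝔸) - 1‖ < 1)
    (A : Site d → Fin d → 𝔸) (w : Site d) (κ : Fin d) :
    ContinuousAt (fun z => clsField L ΛbP η m j (U z) A w κ) z₀ := by
  classical
  unfold clsField
  by_cases h : (w, κ) ∈ ΛbP m j
  · simp only [h, if_true]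
    have hc := continuousAt_linCovIter L hU (B := fun _ => B8Eq146AExpansion.iEta η A) continuousAt_const j hsmall
    have h' : Continuous fun F : Site d → Fin d → 𝔸 => F w κ := (continuous_apply κ).comp (continuous_apply w)
    exact (h'.continuousAt.comp hc).const_smul _
  · simp only [h, if_false]
    exact continuousAt_const

include hU in
/-- ★★ **PRINT'S `Q*aQ(U)A = Σ_{j≤m} w_j Q_jᵀ(𝟙_{Λ_j}LʲηQ_j(U)A)` IS CONTINUOUS IN THE BACKGROUND** (the regime branch of `QQZdP`), at every background whose averages
`Ū_{z₀}ⁱ`, `i < m`, have their loop variables in the disc of (21). [cite: Balaban1985BackgroundPropagators, (3.16) p.393, (3.26) p.395] -/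
theorem continuousAt_QQZdP_branch (ΛbP : ℕ → ℕ → Set (Site d × Fin d)) (i : ZdIdx d L) (m : ℕ)
    (hsmall : ∀ i', i' < m → ∀ (q : Site d) (κ : Fin d) (r : Fin d → Fin L), ‖((Wcx L (avgIter L (U z₀) i') q κ (boxVec L r) : 𝔸ˣ) : 𝔸) - 1‖ < 1)
    (A : Site d → Fin d → 𝔸) (y : Site d) (μ : Fin d) :
    ContinuousAt (fun z => ∑ j ∈ Finset.range (m + 1), (wQ (d := d) L i.η j) • linCovIterT τ L (U z) j (clsField L ΛbP i.η m j (U z) A) y μ) z₀ := by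
  refine tendsto_finsetSum _ fun j hj => ?_
  have hjm : j ≤ m := Nat.lt_succ_iff.1 (Finset.mem_range.1 hj)
  have hsm : ∀ i', i' < j → ∀ (q : Site d) (κ : Fin d) (r : Fin d → Fin L),
      ‖((Wcx L (avgIter L (U z₀) i') q κ (boxVec L r) : 𝔸ˣ) : 𝔸) - 1‖ < 1 := fun i' hi' => hsmall i' (lt_of_lt_of_le hi' hjm)
  exact (continuousAt_linCovIterT τ L hU j hsm (fun w κ => continuousAt_clsField L hU ΛbP i.η m j hsm A w κ) y μ).const_smul _

omit hU in
/-- ★★ **THE TOTAL LETTER `QQZdP` IS CONTINUOUS WITHIN THE REGIME (1.7) AT THE FLAT BACKGROUND**: on any set `𝒰` of backgrounds in the class (1.7) of the member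
(`Reg17 L m i.Ω (α_Q∕L²)`), `QQZdP … U₀ A` is print's `Q*aQ(U₀)A` (the regime branch), continuous at `U₀ = 1` (all averages of `1` are `1`); hence
`U₀ ↦ (Q*aQ(U₀)A)(b)` is continuous WITHIN `𝒰` at `1`. [cite: Balaban1985BackgroundPropagators, (3.16) p.393; Balaban1985RegularSpaces, (1.7) p.77] -/
theorem continuousWithinAt_QQZdP (ΛbP : ℕ → ℕ → Set (Site d × Fin d)) (i : ZdIdx d L) (m : ℕ) {𝒰 : Set (Site d → Fin d → 𝔸ˣ)}
    (hreg : ∀ U₀ ∈ 𝒰, Reg17 L m i.Ω (alphaQ d L / (L : ℝ) ^ 2) U₀) (hL : 1 ≤ L) (A : Site d → Fin d → 𝔸) (y : Site d) (μ : Fin d) :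
    ContinuousWithinAt (fun U₀ => QQZdP τ L ΛbP i m U₀ A y μ) 𝒰 1 := by
  have hb : ContinuousAt (fun U₀ : Site d → Fin d → 𝔸ˣ =>
      ∑ j ∈ Finset.range (m + 1), (wQ (d := d) L i.η j) • linCovIterT τ L U₀ j (clsField L ΛbP i.η m j U₀ A) y μ) 1 := by
    refine continuousAt_QQZdP_branch τ L continuousAt_id ΛbP i m (fun i' _ q κ r => ?_) A y μ
    rw [id, B8Ineq132.avgIter_one, B8Ineq130.Wcx_one, Units.val_one, sub_self, norm_zero]
    exact zero_lt_one
  have hL0 : (0 : ℝ) < L := by exact_mod_cast hL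
  have h1 : Reg17 L m i.Ω (alphaQ d L / (L : ℝ) ^ 2) (1 : Site d → Fin d → 𝔸ˣ) :=
    reg17_one hL (div_pos (B9Eq316AveragingTransposeZd.alphaQ_pos d hL) (pow_pos hL0 2))
  refine (hb.continuousWithinAt (s := 𝒰)).congr (fun U₀ hU₀ => ?_) ?_
  · show QQZdP τ L ΛbP i m U₀ A y μ = _
    unfold QQZdP
    rw [if_pos (hreg U₀ hU₀)]
  · show QQZdP τ L ΛbP i m 1 A y μ = _
    unfold QQZdP
    rw [if_pos h1]

end Averaging

/-! ## §2  The assembly: all four letters of `opsAllZd`'s `Δ_a(U₀)` are continuous within the regime at the flat background -/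

section Assembly

variable (τ : 𝔸 →ₗ[ℂ] ℂ) (hτp : ∀ a : 𝔸, a ≠ 0 → 0 < (τ (star a * a)).re)
  (hτt : ∀ a b : 𝔸, τ (a * b) = τ (b * a)) (hτs : ∀ a : 𝔸, τ (star a) = starRingEnd ℂ (τ a)) {L : ℕ}

include hτt hτs in
/-- ★★★ **THE DISPLAYED HYPOTHESIS OF FILE 1 IS A THEOREM: ALL FOUR LETTERS OF THE GENUINE `Δ_a(U₀)` ARE CONTINUOUS IN THE BACKGROUND, WITHIN THE REGIME, AT
`U₀ = 1`, ON HERMITIAN FIELDS.**  Member data: `Ω₀ = i.Ω 0` finite, finite level-`m` constraint sets `i.Λs m j = Λ_j`, `Q′*` injective at every background,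
`0 < d`, `1 ≤ L`, tracial Hermitian faithful `τ`; regime set `𝒰 ∋ 1` of unitary backgrounds in the class (1.7) of the member whose averaged transporters
`Ū₀ʲ(Γ)`, `j ≤ m`, are unitary.  Letters: `D*D` (FILE 1), `Δ′` (FILE 2), `D R(U₀) 𝟙D*` (FILE 5, on Hermitian `A`), `Q*aQ` (§1).
[cite: Balaban1985BackgroundPropagators, (3.26) p.395, (3.10) p.392, (3.16) p.393, (3.20)–(3.25) p.394; Balaban1985RegularSpaces, (1.7) p.77] -/
theorem lettersContinuousWithinAt_opsAllZd_one (ΛbP : ℕ → ℕ → Set (Site d × Fin d)) (ops₀ : ℝ → ZdIdx d L → ℕ → OpsZd d 𝔸) (M : ℝ) (i : ZdIdx d L)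
    (m : ℕ) (hΩ : (i.Ω 0).Finite) {Λ : ℕ → Finset (Site d)} (hΛ : i.Λs m = fun j => (↑(Λ j) : Set (Site d))) (hd : 0 < d) (hL : 1 ≤ L)
    (hinj : ∀ U₀ : Site d → Fin d → 𝔸ˣ, QprimeStarInjective L U₀ τ hτp m Λ hΩ.toFinset)
    {𝒰 : Set (Site d → Fin d → 𝔸ˣ)} (h1 : (1 : Site d → Fin d → 𝔸ˣ) ∈ 𝒰)
    (hunit : ∀ U₀ ∈ 𝒰, ∀ (x : Site d) (κ : Fin d), U₀ x κ ∈ unitaryUnits 𝔸)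
    (hreg : ∀ U₀ ∈ 𝒰, Reg17 L m i.Ω (alphaQ d L / (L : ℝ) ^ 2) U₀)
    (hT : ∀ U₀ ∈ 𝒰, ∀ j, j ≤ m → ∀ (x y : Site d), bgT L U₀ j x y ∈ unitaryUnits 𝔸) :
    LettersContinuousWithinAt i.η (opsAllZd τ L ΛbP ops₀ M i m) (i.Ω 0) (domSubH (i.Ω 0)) 𝒰 1 := by
  intro A hA y μ _
  have hAh : ∀ (w : Site d) (κ : Fin d), IsSelfAdjoint (A w κ) := ((mem_domSubH_iff (i.Ω 0) A).1 hA).2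
  -- the `D R D*` letter: continuity on the subtype `𝒰` at `⟨1, h1⟩`
  have h3 : ContinuousWithinAt (fun U₀ => (opsLandau τ (withDpZd (withQQP τ L ΛbP ops₀)) M i m).DRDs U₀ A y μ) 𝒰 1 := by
    rw [continuousWithinAt_iff_continuousAt_restrict _ h1]
    have hval : ContinuousAt (fun z : 𝒰 => (z : Site d → Fin d → 𝔸ˣ)) ⟨1, h1⟩ := continuous_subtype_val.continuousAt
    have hbgT : ∀ j, j < m + 1 → ∀ (y' x' : Site d), ContinuousAt (fun z : 𝒰 => bgT L (z : Site d → Fin d → 𝔸ˣ) j y' x') ⟨1, h1⟩ := by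
      intro j _ y' x'
      refine continuousAt_bgT L hval j (fun i' _ q κ r => ?_) y' x'
      show ‖((Wcx L (avgIter L (1 : Site d → Fin d → 𝔸ˣ) i') q κ (boxVec L r) : 𝔸ˣ) : 𝔸) - 1‖ < 1
      rw [B8Ineq132.avgIter_one, B8Ineq130.Wcx_one, Units.val_one, sub_self, norm_zero]
      exact zero_lt_one
    exact continuousAt_DRDs_opsLandau τ hτp hτt hτs (withDpZd (withQQP τ L ΛbP ops₀)) M i m hΩ hΛ hval hbgT hd (fun z => hunit z.1 z.2)
      (fun z => hinj z.1) (fun z => hT z.1 z.2) hAh y μ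
  have h4 := continuousWithinAt_QQZdP τ L ΛbP i m hreg hL A y μ
  have h12 := B9Eq310DeltaPrimeContinuityZd.continuousWithinAt_Jcur_add_DpZd i.η A y μ 𝒰 (1 : Site d → Fin d → 𝔸ˣ)
  have h := (h12.add h3).add h4
  refine h.congr (fun U₀ _ => ?_) ?_ <;>
    simp only [deltaAOf, opsAllZd_Dp, opsAllZd_DRDs, opsAllZd_QQ, Pi.add_apply]

end Assembly

/-! ## §3  At the cube members: Theorem 3.11's positivity ∕ (3.27)'s invertibility for all regime backgrounds near the flat one -/

section Cube

open B8Eq131Cubes (cube sqLo sqHi)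
open B8Eq131CubesAdmissible (cubeFam cubeFam_false_zero)
open B8CubeMemberZd (cubeLamS)
open B8Ineq159FlatCubeMemberPrinted (cubeLamBP)
open B8Eq191FlatLettersCubeMember (cubeLamS_finite cubeFam_zero_finite)
open B8CubeMemberLevelDisjoint (qprimeStarInjective_cubeLamS)
open B9Thm311PosDefOpenZd (cubeMember_Ω0_finite bondPair_pos_eventually_one_cube regularAtH_eventually_one_cube)

variable (τ : 𝔸 →ₗ[ℂ] ℂ) (hτp : ∀ a : 𝔸, a ≠ 0 → 0 < (τ (star a * a)).re)
  (hτt : ∀ a b : 𝔸, τ (a * b) = τ (b * a)) (hτs : ∀ a : 𝔸, τ (star a) = starRingEnd ℂ (τ a)) {L : ℕ}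

include hτs in
omit [Nontrivial 𝔸] in
/-- **«Q′ ONTO» AT THE CUBE MEMBER, in the shape §2 consumes** (dag-n05-c's `qprimeStarInjective_cubeLamS` BY NAME, finsets re-keyed to `i.Ω 0`).
[cite: Balaban1985BackgroundPropagators, (3.18)–(3.19) p.393; Balaban1985RegularSpaces, (1.131) p.99] -/
theorem qprimeStarInjective_cubeMember [NeZero L] (i : ZdIdx d L) {a : Site d} {Mc ρ : ℕ} (hΩ : i.Ω = cubeFam false L a Mc ρ i.k) (hρ : L ≤ ρ)
    {m : ℕ} (hm : m ≤ i.k) (U₀ : Site d → Fin d → 𝔸ˣ) :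
    QprimeStarInjective L U₀ τ hτp m (fun j => (cubeLamS_finite L a Mc ρ i.k m j).toFinset) (cubeMember_Ω0_finite i hΩ).toFinset := by
  have hs : (cubeMember_Ω0_finite i hΩ).toFinset = (cubeFam_zero_finite L a Mc ρ i.k).toFinset := by
    apply Finset.coe_injective
    rw [Set.Finite.coe_toFinset, Set.Finite.coe_toFinset, hΩ]
  rw [hs]
  exact qprimeStarInjective_cubeLamS a Mc hρ hm U₀ τ hτp hτs

include hτp hτt hτs in
/-- ★★★ **ALL FOUR LETTERS OF THE GENUINE `Δ_a(U₀)` ARE CONTINUOUS WITHIN THE REGIME AT `U₀ = 1`, AT EVERY CUBE MEMBER** (`Ω = cubeFam false L a Mc ρ k`,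
`Λs = cubeLamS …`, `m ≤ k`, `0 < d`, `1 ≤ L ≤ ρ`, any class `ΛbP`, faithful Hermitian tracial `τ`): `LettersContinuousWithinAt … (opsAllZd …) (□₀) (E_𝔤(□₀)) 𝒰 1` for
every `𝒰 ∋ 1` of unitary backgrounds in the class (1.7) of the member with `Ū₀ʲ(Γ)` unitary for `j ≤ m`. [cite: Balaban1985BackgroundPropagators, (3.26) p.395, Thm 3.11 p.416; Balaban1985RegularSpaces, (1.7) p.77, (1.131) p.99] -/
theorem lettersContinuousWithinAt_opsAllZd_one_cube [NeZero L] (ΛbP : ℕ → ℕ → Set (Site d × Fin d)) (ops₀ : ℝ → ZdIdx d L → ℕ → OpsZd d 𝔸)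
    (M : ℝ) (i : ZdIdx d L) {a : Site d} {Mc ρ : ℕ} (hΩ : i.Ω = cubeFam false L a Mc ρ i.k) (hΛs : i.Λs = cubeLamS L a Mc ρ i.k) (hρ : L ≤ ρ)
    {m : ℕ} (hm : m ≤ i.k) (hd : 0 < d) (hL : 1 ≤ L)
    {𝒰 : Set (Site d → Fin d → 𝔸ˣ)} (h1 : (1 : Site d → Fin d → 𝔸ˣ) ∈ 𝒰)
    (hunit : ∀ U₀ ∈ 𝒰, ∀ (x : Site d) (κ : Fin d), U₀ x κ ∈ unitaryUnits 𝔸)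
    (hreg : ∀ U₀ ∈ 𝒰, Reg17 L m i.Ω (alphaQ d L / (L : ℝ) ^ 2) U₀)
    (hT : ∀ U₀ ∈ 𝒰, ∀ j, j ≤ m → ∀ (x y : Site d), bgT L U₀ j x y ∈ unitaryUnits 𝔸) :
    LettersContinuousWithinAt i.η (opsAllZd τ L ΛbP ops₀ M i m) (i.Ω 0) (domSubH (i.Ω 0)) 𝒰 1 := by
  have hΛ : i.Λs m = fun j => (↑((cubeLamS_finite L a Mc ρ i.k m j).toFinset) : Set (Site d)) := by
    funext j
    simp only [Set.Finite.coe_toFinset, hΛs]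
  exact lettersContinuousWithinAt_opsAllZd_one τ hτp hτt hτs ΛbP ops₀ M i m (cubeMember_Ω0_finite i hΩ) hΛ hd hL
    (qprimeStarInjective_cubeMember τ hτp hτs i hΩ hρ hm) h1 hunit hreg hT

include hτp hτt hτs in
/-- ★★★ **THEOREM 3.11's POSITIVITY FOR THE GENUINE `Δ_a(U₀)` AT CURVED BACKGROUNDS NEAR THE FLAT ONE, EVERY CUBE MEMBER** (class `cubeLamBP`, `m ≤ k`,
`d, L ≥ 2`, `L ≤ ρ`; regime set `𝒰 ∋ 1` ⊆ {unitary} ∩ (1.7) ∩ {`Ū₀ʲ` unitary, `j ≤ m`}): IF `Δ_a(U₀)` is ℝ-linear on `E(□₀)` for `U₀ ∈ 𝒰` (dag-n06-w2 g3's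
`LinearOnDomAt` road), THEN for all `U₀ ∈ 𝒰` near `1` and every Hermitian `0 ≠ A ∈ E(□₀)`, `0 < ⟨A, Δ_a(U₀)A⟩_τ` — dag-n06-b's flat base case propagated by
FILE 1's engine through the continuity proved here. [cite: Balaban1985BackgroundPropagators, Thm 3.11 p.416, (3.26) p.395; Balaban1984PropagatorsII, (2.11) p.225] -/
theorem bondPair_pos_eventually_one_cube_of_lin [NeZero L] (hd2 : 2 ≤ d) (hL2 : 2 ≤ L) (ops₀ : ℝ → ZdIdx d L → ℕ → OpsZd d 𝔸) (M : ℝ)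
    (i : ZdIdx d L) {a : Site d} {Mc ρ : ℕ} (hΩ : i.Ω = cubeFam false L a Mc ρ i.k) (hΛs : i.Λs = cubeLamS L a Mc ρ i.k) (hρ : L ≤ ρ)
    {m : ℕ} (hm : m ≤ i.k) {𝒰 : Set (Site d → Fin d → 𝔸ˣ)} (h1 : (1 : Site d → Fin d → 𝔸ˣ) ∈ 𝒰)
    (hunit : ∀ U₀ ∈ 𝒰, ∀ (x : Site d) (κ : Fin d), U₀ x κ ∈ unitaryUnits 𝔸)
    (hreg : ∀ U₀ ∈ 𝒰, Reg17 L m i.Ω (alphaQ d L / (L : ℝ) ^ 2) U₀)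
    (hT : ∀ U₀ ∈ 𝒰, ∀ j, j ≤ m → ∀ (x y : Site d), bgT L U₀ j x y ∈ unitaryUnits 𝔸)
    (hlin : ∀ U₀ ∈ 𝒰, LinearOnDomAt i.η (opsAllZd τ L (cubeLamBP L a Mc ρ i.k) ops₀ M i m) (i.Ω 0) U₀) :
    ∀ᶠ U₀ in 𝓝[𝒰] (1 : Site d → Fin d → 𝔸ˣ), ∀ A ∈ domSubH (𝔸 := 𝔸) (i.Ω 0), A ≠ 0 →
      0 < bondPair τ A (deltaAOf i.η (opsAllZd τ L (cubeLamBP L a Mc ρ i.k) ops₀ M i m) U₀ A) :=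
  bondPair_pos_eventually_one_cube τ hτt hτs hτp hd2 hL2 ops₀ M i hΩ hΛs hm h1 hlin
    (lettersContinuousWithinAt_opsAllZd_one_cube τ hτp hτt hτs (cubeLamBP L a Mc ρ i.k) ops₀ M i hΩ hΛs hρ hm (by omega) (by omega) h1 hunit hreg hT)

include hτp hτt hτs in
/-- ★★★ **(3.27) AT CURVED BACKGROUNDS NEAR THE FLAT ONE: `Δ_a(U₀)↾□₀` IS INVERTIBLE ON `E_𝔤(□₀)` — `G_𝔤(U₀) = (□₀Δ_a(U₀)□₀)⁻¹` EXISTS — FOR ALL `U₀ ∈ 𝒰` NEAR `1`**,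
at every cube member as above, given ℝ-linearity AND Hermiticity preservation of `Δ_a(U₀)` on `𝒰` (dag-n06-w2 g3's two structural inputs).
[cite: Balaban1985BackgroundPropagators, Thm 3.11 p.416, (3.27) p.395] -/
theorem regularAtH_eventually_one_cube_of_lin_herm [NeZero L] (hd2 : 2 ≤ d) (hL2 : 2 ≤ L) (ops₀ : ℝ → ZdIdx d L → ℕ → OpsZd d 𝔸) (M : ℝ)
    (i : ZdIdx d L) {a : Site d} {Mc ρ : ℕ} (hΩ : i.Ω = cubeFam false L a Mc ρ i.k) (hΛs : i.Λs = cubeLamS L a Mc ρ i.k) (hρ : L ≤ ρ)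
    {m : ℕ} (hm : m ≤ i.k) {𝒰 : Set (Site d → Fin d → 𝔸ˣ)} (h1 : (1 : Site d → Fin d → 𝔸ˣ) ∈ 𝒰)
    (hunit : ∀ U₀ ∈ 𝒰, ∀ (x : Site d) (κ : Fin d), U₀ x κ ∈ unitaryUnits 𝔸)
    (hreg : ∀ U₀ ∈ 𝒰, Reg17 L m i.Ω (alphaQ d L / (L : ℝ) ^ 2) U₀)
    (hT : ∀ U₀ ∈ 𝒰, ∀ j, j ≤ m → ∀ (x y : Site d), bgT L U₀ j x y ∈ unitaryUnits 𝔸)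
    (hlin : ∀ U₀ ∈ 𝒰, LinearOnDomAt i.η (opsAllZd τ L (cubeLamBP L a Mc ρ i.k) ops₀ M i m) (i.Ω 0) U₀)
    (hherm : ∀ U₀ ∈ 𝒰, HermPreservingAt i.η (opsAllZd τ L (cubeLamBP L a Mc ρ i.k) ops₀ M i m) (i.Ω 0) U₀) :
    ∀ᶠ U₀ in 𝓝[𝒰] (1 : Site d → Fin d → 𝔸ˣ), RegularAtH i.η (opsAllZd τ L (cubeLamBP L a Mc ρ i.k) ops₀ M i m) (i.Ω 0) U₀ :=
  regularAtH_eventually_one_cube τ hτt hτs hτp hd2 hL2 ops₀ M i hΩ hΛs hm h1 hlin hherm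
    (lettersContinuousWithinAt_opsAllZd_one_cube τ hτp hτt hτs (cubeLamBP L a Mc ρ i.k) ops₀ M i hΩ hΛs hρ hm (by omega) (by omega) h1 hunit hreg hT)

include hτp hτt hτs in
/-- ★★ **THE BOND-VARIABLE READING**: at every cube member as above (ℝ-linearity on `𝒰` given) there are a FINITE set `F ⊂ ℤᵈ` and `δ > 0` such that EVERY
background `U₀ ∈ 𝒰` with `‖U₀(y, μ) − 1‖ < δ` for `y ∈ F` — in particular every `U₀ ∈ 𝒰` uniformly `δ`-close to `1` — has `⟨A, Δ_a(U₀)A⟩_τ > 0` for all Hermitian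
`0 ≠ A ∈ E(□₀)` (FILE 1 §5). [cite: Balaban1985BackgroundPropagators, Thm 3.11 p.416, (3.35) p.396] -/
theorem exists_finset_delta_posDef_cube_of_lin [NeZero L] (hd2 : 2 ≤ d) (hL2 : 2 ≤ L) (ops₀ : ℝ → ZdIdx d L → ℕ → OpsZd d 𝔸) (M : ℝ)
    (i : ZdIdx d L) {a : Site d} {Mc ρ : ℕ} (hΩ : i.Ω = cubeFam false L a Mc ρ i.k) (hΛs : i.Λs = cubeLamS L a Mc ρ i.k) (hρ : L ≤ ρ)
    {m : ℕ} (hm : m ≤ i.k) {𝒰 : Set (Site d → Fin d → 𝔸ˣ)} (h1 : (1 : Site d → Fin d → 𝔸ˣ) ∈ 𝒰)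
    (hunit : ∀ U₀ ∈ 𝒰, ∀ (x : Site d) (κ : Fin d), U₀ x κ ∈ unitaryUnits 𝔸)
    (hreg : ∀ U₀ ∈ 𝒰, Reg17 L m i.Ω (alphaQ d L / (L : ℝ) ^ 2) U₀)
    (hT : ∀ U₀ ∈ 𝒰, ∀ j, j ≤ m → ∀ (x y : Site d), bgT L U₀ j x y ∈ unitaryUnits 𝔸)
    (hlin : ∀ U₀ ∈ 𝒰, LinearOnDomAt i.η (opsAllZd τ L (cubeLamBP L a Mc ρ i.k) ops₀ M i m) (i.Ω 0) U₀) :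
    ∃ (F : Finset (Site d)) (δ : ℝ), 0 < δ ∧ ∀ U₀ ∈ 𝒰, (∀ y ∈ F, ∀ μ : Fin d, ‖(U₀ y μ : 𝔸) - (1 : Site d → Fin d → 𝔸ˣ) y μ‖ < δ) →
      ∀ A ∈ domSubH (𝔸 := 𝔸) (i.Ω 0), A ≠ 0 → 0 < bondPair τ A (deltaAOf i.η (opsAllZd τ L (cubeLamBP L a Mc ρ i.k) ops₀ M i m) U₀ A) :=
  exists_finset_ball_of_eventually_nhdsWithin
    (bondPair_pos_eventually_one_cube_of_lin τ hτp hτt hτs hd2 hL2 ops₀ M i hΩ hΛs hρ hm h1 hunit hreg hT hlin)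

end Cube

/-! ## §4  UNCONDITIONAL CLOSE ON dag-n06-w2 g3's REGIME SET `𝒰′ = {U₀ unitary, (1.7) on ℤᵈ up to level m at window α_Q∕L²}`:
Theorem 3.11's positivity and (3.27)'s invertibility at every cube member for all `U₀ ∈ 𝒰′` near the flat background -/

section Regime

open B7Prop2Explicit (pdev avgIter_mem avgClosed_unitaryUnits hol_plaqWord_self hol_mem_of C0 c2' C0_pos)
open B9Eq316AveragingTransposeZd (alphaQ_pos C0_mul_alphaQ_le four_mul_alphaQ_le)
open B8Eq131CubesAdmissible (cubeFam)
open B8CubeMemberZd (cubeLamS)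
open B8Ineq159FlatCubeMemberPrinted (cubeLamBP)
open B9Eq326DeltaAHermitianZdCurved (one_mem_reg17UnivP linear_herm_on_reg17UnivP)
open B9Thm311PosDefOpenZd (cubeMember_Ω0_finite)

variable {L : ℕ}

omit [FiniteDimensional ℝ 𝔸] [Nontrivial 𝔸] in
/-- the class (1.7) on all of `ℤᵈ` restricts to the class (1.7) of any member's domains. [cite: Balaban1985RegularSpaces, (1.7) p.77] -/
theorem reg17_of_univ {m : ℕ} {Ω : ℕ → Set (Site d)} {α : ℝ} {U₀ : Site d → Fin d → 𝔸ˣ}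
    (h : Reg17 L m (fun _ => (Set.univ : Set (Site d))) α U₀) : Reg17 L m Ω α U₀ :=
  fun j hj x μ ν hμν _ => h j hj x μ ν hμν (Or.inl (Set.mem_univ _))

omit [FiniteDimensional ℝ 𝔸] in
/-- ★ **ON `𝒰′` THE AVERAGED TRANSPORTERS `Ū₀ʲ(Γ)`, `j ≤ m`, ARE UNITARY** ([Balaban1985Averaging] Prop. 2 for the unitary group, `B7Prop2Explicit.avgIter_mem`, in
the window `α₀ = 2α_Q∕L²`: the class (1.7) on `ℤᵈ` at level `m` bounds every plaquette variable, hence `pdev U₀ ≤ (α_Q∕L²)L^{−2m} < α₀L^{−2m}`; `L ≥ 2`,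
`d > 0`). [cite: Balaban1985Averaging, Prop. 2 (52)–(54) p.26, (42)–(43) p.23; Balaban1985RegularSpaces, (1.7) p.77, (1.29) p.81] -/
theorem bgT_mem_unitaryUnits_of_reg17UnivP (hd : 0 < d) (hL : 2 ≤ L) (m : ℕ) {U₀ : Site d → Fin d → 𝔸ˣ}
    (hU : ∀ (x : Site d) (κ : Fin d), U₀ x κ ∈ unitaryUnits 𝔸)
    (hreg : Reg17 L m (fun _ => (Set.univ : Set (Site d))) (alphaQ d L / (L : ℝ) ^ 2) U₀) :
    ∀ j, j ≤ m → ∀ (x y : Site d), bgT L U₀ j x y ∈ unitaryUnits 𝔸 := by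
  have hL1 : 1 ≤ L := le_trans one_le_two hL
  have hLr : (2 : ℝ) ≤ L := by exact_mod_cast hL
  have hL0 : (0 : ℝ) < L := by linarith
  have hαQ : 0 < alphaQ d L := alphaQ_pos d hL1
  have hL2 : (4 : ℝ) ≤ (L : ℝ) ^ 2 := by nlinarith
  set β : ℝ := alphaQ d L / (L : ℝ) ^ 2 with hβ
  have hβpos : 0 < β := div_pos hαQ (by positivity)
  have hβle : β ≤ alphaQ d L / 4 := by
    rw [hβ]
    exact div_le_div_of_nonneg_left hαQ.le (by norm_num) hL2
  have hα : 0 < 2 * β := by positivity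
  have hα3 : C0 d * (2 * β) ≤ 1 / 3 := by
    have h1 := C0_mul_alphaQ_le d L
    have hC := (C0_pos d).le
    nlinarith [mul_le_mul_of_nonneg_left hβle hC]
  have hα2 : 2 * (2 * β) ≤ c2' d L := by
    have h1 := four_mul_alphaQ_le d L
    linarith
  -- the plaquette deviation on all of `ℤᵈ`
  haveI : Nonempty (Site d × Fin d × Fin d) := ⟨(0, ⟨0, hd⟩, ⟨0, hd⟩)⟩
  have hpdev : pdev U₀ ≤ β * (((L : ℝ) ^ m)⁻¹) ^ 2 := by
    refine ciSup_le fun p => ?_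
    rcases p with ⟨x, μ, ν⟩
    by_cases hμν : μ = ν
    · subst hμν
      rw [hol_plaqWord_self, Units.val_one, sub_self, norm_zero]
      positivity
    · exact (hreg m le_rfl x μ ν hμν (Or.inl (Set.mem_univ _))).le
  have h52 : pdev U₀ < 2 * β * (((L : ℝ) ^ m)⁻¹) ^ 2 := by
    have hpos : 0 < β * (((L : ℝ) ^ m)⁻¹) ^ 2 := by positivity
    linarith
  intro j hj x y
  have hmem := avgIter_mem L hL (avgClosed_unitaryUnits d L) m U₀ hU hα hα3 hα2 h52 j hj
  unfold bgT axialFn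
  exact hol_mem_of hmem _ _

variable (τ : 𝔸 →ₗ[ℂ] ℂ) (hτp : ∀ a : 𝔸, a ≠ 0 → 0 < (τ (star a * a)).re)
  (hτt : ∀ a b : 𝔸, τ (a * b) = τ (b * a)) (hτs : ∀ a : 𝔸, τ (star a) = starRingEnd ℂ (τ a))

include hτp hτt hτs in
/-- ★★★★ **[B9] THEOREM 3.11's POSITIVITY AT CURVED BACKGROUNDS NEAR THE FLAT ONE — UNCONDITIONAL, EVERY CUBE MEMBER**: at a cube member of
[Balaban1985RegularSpaces] (1.131) (`Ω = cubeFam false L a Mc ρ k`, `Λs = cubeLamS …`; class `cubeLamBP`; `m ≤ k`; `d, L ≥ 2`, `L ≤ ρ`; faithful Hermitian tracial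
`τ` on a finite-dimensional fibre), with `𝒰′ = {U₀ unitary, in the class (1.7) on ℤᵈ up to level m at window α_Q∕L²}` (dag-n06-w2 g3's regime set, `1 ∈ 𝒰′`):
FOR ALL `U₀ ∈ 𝒰′` NEAR `U₀ = 1`, `0 < ⟨A, Δ_a(U₀)A⟩_τ` for every Hermitian `0 ≠ A ∈ E(□₀)` — the genuine four-letter `Δ_a(U₀)` (`opsAllZd`).  Chain: dag-n06-b's flat base
case (`flat_posDef_herm_cube`) + this seat's engine (FILE 1) + the continuity of the four letters (FILEs 1–3, 5, §§1–3) + dag-n06-w2 g3's ℝ-linearity on `𝒰′`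
(`linear_herm_on_reg17UnivP`) + unitarity of `Ū₀ʲ`, `j ≤ m`, on `𝒰′` ([5] Prop. 2).  The neighbourhood is member-dependent (compactness), not print's uniform
`α₀′`. [cite: Balaban1985BackgroundPropagators, Thm 3.11 p.416, (3.26) p.395; Balaban1984PropagatorsII, (2.11) p.225; Balaban1985RegularSpaces, (1.7) p.77, (1.131) p.99] -/
theorem bondPair_pos_eventually_one_cube_reg17UnivP [NeZero L] (hd2 : 2 ≤ d) (hL2 : 2 ≤ L) (ops₀ : ℝ → ZdIdx d L → ℕ → OpsZd d 𝔸) (M : ℝ)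
    (i : ZdIdx d L) {a : Site d} {Mc ρ : ℕ} (hΩ : i.Ω = cubeFam false L a Mc ρ i.k) (hΛs : i.Λs = cubeLamS L a Mc ρ i.k) (hρ : L ≤ ρ)
    {m : ℕ} (hm : m ≤ i.k) :
    ∀ᶠ U₀ in 𝓝[{U₀ : Site d → Fin d → 𝔸ˣ | (∀ x κ, U₀ x κ ∈ unitaryUnits 𝔸) ∧
        Reg17 L m (fun _ => (Set.univ : Set (Site d))) (alphaQ d L / (L : ℝ) ^ 2) U₀}] (1 : Site d → Fin d → 𝔸ˣ),
      ∀ A ∈ domSubH (𝔸 := 𝔸) (i.Ω 0), A ≠ 0 → 0 < bondPair τ A (deltaAOf i.η (opsAllZd τ L (cubeLamBP L a Mc ρ i.k) ops₀ M i m) U₀ A) := by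
  have hL1 : 1 ≤ L := le_trans one_le_two hL2
  have hstr := linear_herm_on_reg17UnivP τ hτt hτs hτp hL2 (cubeLamBP L a Mc ρ i.k) ops₀ M i m (cubeMember_Ω0_finite i hΩ)
  exact bondPair_pos_eventually_one_cube_of_lin τ hτp hτt hτs hd2 hL2 ops₀ M i hΩ hΛs hρ hm (one_mem_reg17UnivP hL1 m)
    (fun U₀ hU => hU.1) (fun U₀ hU => reg17_of_univ hU.2)
    (fun U₀ hU => bgT_mem_unitaryUnits_of_reg17UnivP (lt_of_lt_of_le zero_lt_two hd2) hL2 m hU.1 hU.2) hstr.1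

include hτp hτt hτs in
/-- ★★★★ **[B9] (3.27) AT CURVED BACKGROUNDS NEAR THE FLAT ONE — UNCONDITIONAL, EVERY CUBE MEMBER**: with the data of the previous theorem, FOR ALL `U₀ ∈ 𝒰′` NEAR
`1`, `Δ_a(U₀)↾□₀` IS AN INVERTIBLE OPERATOR OF `E_𝔤(□₀)` (`RegularAtH`: the propagator `G_𝔤(U₀) = (□₀Δ_a(U₀)□₀)⁻¹` EXISTS there) — positivity + dag-n06-w2 g3's
Hermiticity preservation on `𝒰′` + dag-n06-b's `regularAtH_of_bondPair_pos`. [cite: Balaban1985BackgroundPropagators, Thm 3.11 p.416, (3.27) p.395; Balaban1985RegularSpaces, (1.7) p.77, (1.131) p.99] -/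
theorem regularAtH_eventually_one_cube_reg17UnivP [NeZero L] (hd2 : 2 ≤ d) (hL2 : 2 ≤ L) (ops₀ : ℝ → ZdIdx d L → ℕ → OpsZd d 𝔸) (M : ℝ)
    (i : ZdIdx d L) {a : Site d} {Mc ρ : ℕ} (hΩ : i.Ω = cubeFam false L a Mc ρ i.k) (hΛs : i.Λs = cubeLamS L a Mc ρ i.k) (hρ : L ≤ ρ)
    {m : ℕ} (hm : m ≤ i.k) :
    ∀ᶠ U₀ in 𝓝[{U₀ : Site d → Fin d → 𝔸ˣ | (∀ x κ, U₀ x κ ∈ unitaryUnits 𝔸) ∧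
        Reg17 L m (fun _ => (Set.univ : Set (Site d))) (alphaQ d L / (L : ℝ) ^ 2) U₀}] (1 : Site d → Fin d → 𝔸ˣ),
      RegularAtH i.η (opsAllZd τ L (cubeLamBP L a Mc ρ i.k) ops₀ M i m) (i.Ω 0) U₀ := by
  have hL1 : 1 ≤ L := le_trans one_le_two hL2
  have hstr := linear_herm_on_reg17UnivP τ hτt hτs hτp hL2 (cubeLamBP L a Mc ρ i.k) ops₀ M i m (cubeMember_Ω0_finite i hΩ)
  exact regularAtH_eventually_one_cube_of_lin_herm τ hτp hτt hτs hd2 hL2 ops₀ M i hΩ hΛs hρ hm (one_mem_reg17UnivP hL1 m)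
    (fun U₀ hU => hU.1) (fun U₀ hU => reg17_of_univ hU.2)
    (fun U₀ hU => bgT_mem_unitaryUnits_of_reg17UnivP (lt_of_lt_of_le zero_lt_two hd2) hL2 m hU.1 hU.2) hstr.1 hstr.2

include hτp hτt hτs in
/-- ★★★ **THE BOND-VARIABLE READING, UNCONDITIONAL**: at every cube member as above there are a FINITE `F ⊂ ℤᵈ` and `δ > 0` such that every unitary background `U₀`
in the class (1.7) on `ℤᵈ` (window `α_Q∕L²`, up to level `m`) with `‖U₀(y, μ) − 1‖ < δ` for `y ∈ F` — in particular every such `U₀` uniformly `δ`-close to `1` —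
gives `0 < ⟨A, Δ_a(U₀)A⟩_τ` for all Hermitian `0 ≠ A ∈ E(□₀)`. [cite: Balaban1985BackgroundPropagators, Thm 3.11 p.416, (3.35) p.396; Balaban1985RegularSpaces, (1.7) p.77] -/
theorem exists_finset_delta_posDef_cube_reg17UnivP [NeZero L] (hd2 : 2 ≤ d) (hL2 : 2 ≤ L) (ops₀ : ℝ → ZdIdx d L → ℕ → OpsZd d 𝔸) (M : ℝ)
    (i : ZdIdx d L) {a : Site d} {Mc ρ : ℕ} (hΩ : i.Ω = cubeFam false L a Mc ρ i.k) (hΛs : i.Λs = cubeLamS L a Mc ρ i.k) (hρ : L ≤ ρ)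
    {m : ℕ} (hm : m ≤ i.k) :
    ∃ (F : Finset (Site d)) (δ : ℝ), 0 < δ ∧ ∀ U₀ : Site d → Fin d → 𝔸ˣ, (∀ x κ, U₀ x κ ∈ unitaryUnits 𝔸) →
      Reg17 L m (fun _ => (Set.univ : Set (Site d))) (alphaQ d L / (L : ℝ) ^ 2) U₀ →
      (∀ y ∈ F, ∀ μ : Fin d, ‖(U₀ y μ : 𝔸) - 1‖ < δ) →
      ∀ A ∈ domSubH (𝔸 := 𝔸) (i.Ω 0), A ≠ 0 → 0 < bondPair τ A (deltaAOf i.η (opsAllZd τ L (cubeLamBP L a Mc ρ i.k) ops₀ M i m) U₀ A) := by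
  obtain ⟨F, δ, hδ, h⟩ := exists_finset_ball_of_eventually_nhdsWithin
    (bondPair_pos_eventually_one_cube_reg17UnivP τ hτp hτt hτs hd2 hL2 ops₀ M i hΩ hΛs hρ hm)
  refine ⟨F, δ, hδ, fun U₀ hu hr hclose => h U₀ ⟨hu, hr⟩ fun y hy μ => ?_⟩
  have := hclose y hy μ
  simpa only [Pi.one_apply, Units.val_one] using this

end Regime

end Literature.MathematicalPhysics.QuantumFieldTheory.Balaban1983to89.B9Thm311PosDefNearFlatZd

end
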